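import Mathlib
import Literature.NumberTheory.Sieve.LinearEquationsInPrimes

/-!
# Sloped ladder — the rung assembly (`stub_slopedRung`)

Route `LiouvilleShiftedTables` (Parity / GeneralizedHardyLittlewood), crux stmt-Parity-9389
(`PairsToGHL`), line `sloped_ladder`, stub `stub_slopedRung` (assembly form).

One rung of Bombieri's asymptotic-sieve ladder `ElemHL_t ∧ Level_t ∧ Atoms_t ⇒ ElemHL_{t+1}`,
assembled from three `o(N)` piece-families which are taken as hypotheses.  For a positive
non-degenerate `(t+1)`-system `Φ' = vecCons ψ Φ` (`ψ = Φ' 0`, `Φ = tail Φ'`), writing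
`m = ψ(n)`, `F(n) = ∏ᵢ Λ(Φᵢ(n))`, `M₀ = ⌊N^{ε₁}⌋`, `X = m / (M₀ + 1)`:

* `Λ(m) = ∑_{de = m} μ(d) log e` (Mathlib's `moebius_mul_log_eq_vonMangoldt`);
* the pairs `(d, e)` with `e ≤ M₀` form the atoms piece (A);
* the pairs with `e > M₀` are `∑_{d ≤ X, d ∣ m} μ(d) log(m/d)`, and writing the indicator as
  `𝟙[d ∣ m] = W(d) + (𝟙[d ∣ m] - W(d))` splits them into the main piece (M) and the level
  piece (E), for any weights `W`;

so `∑_{n ≤ N} ∏ᵢ Λ(Φ'ᵢ(n)) = A(N) + E(N) + M(N)` exactly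
(`RungAssembly.sum_vonMangoldt_mul_split`), and the three bounds `|A|, |E|, |M - 𝔖 N| ≤ (c/3) N`
give `∑_{n ≤ N} ∏ᵢ Λ(Φ'ᵢ(n)) - 𝔖(Φ') N = o(N)` (`RungAssembly.isLittleO_of_pieces`).

[folklore]
-/

noncomputable section

open Finset Filter ArithmeticFunction
open scoped ArithmeticFunction.Moebius

namespace Summit.Parity.GeneralizedHardyLittlewood.Theorems.PairsToGHL.SlopedLadder

open Literature.NumberTheory.Sieve

namespace RungAssembly

variable {t : ℕ}

/-! ### Opening `Λ(m)` and splitting the divisor pairs -/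

/-- `Λ(m) = ∑_{de = m} μ(d) log e` (Mathlib's `μ * log = Λ`). [folklore] -/
theorem vonMangoldt_eq_sum_antidiagonal (m : ℕ) :
    (Λ m : ℝ) = ∑ x ∈ Nat.divisorsAntidiagonal m, (μ x.1 : ℝ) * Real.log x.2 := by
  have e : (Λ m : ℝ) = ((μ : ArithmeticFunction ℝ) * ArithmeticFunction.log) m := by
    rw [moebius_mul_log_eq_vonMangoldt]
  rw [e, mul_apply]
  exact Finset.sum_congr rfl fun x _ => by rw [intCoe_apply, log_apply]

/-- The divisors `d` of `m` with cofactor `m / d > M₀` are exactly the divisors `d` of `m` with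
`1 ≤ d ≤ m / (M₀ + 1)`. [folklore] -/
theorem filter_divisors_eq (m M₀ : ℕ) :
    (Nat.divisors m).filter (fun d => ¬ m / d ≤ M₀) =
      (Icc 1 (m / (M₀ + 1))).filter (fun d => d ∣ m) := by
  ext d
  simp only [Finset.mem_filter, Nat.mem_divisors, Finset.mem_Icc, not_le]
  constructor
  · rintro ⟨⟨hd, hm⟩, hlt⟩
    have hd0 : 0 < d := Nat.pos_of_dvd_of_pos hd (Nat.pos_of_ne_zero hm)
    refine ⟨⟨hd0, ?_⟩, hd⟩
    rw [Nat.le_div_iff_mul_le (Nat.succ_pos M₀)]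
    have h1 : (M₀ + 1) * d ≤ m := (Nat.le_div_iff_mul_le hd0).mp hlt
    rw [Nat.mul_comm]
    exact h1
  · rintro ⟨⟨hd0, hle⟩, hd⟩
    have h1 : d * (M₀ + 1) ≤ m := (Nat.le_div_iff_mul_le (Nat.succ_pos M₀)).mp hle
    have hm : m ≠ 0 := by
      rintro rfl
      exact absurd h1 (not_le.mpr (Nat.mul_pos hd0 (Nat.succ_pos M₀)))
    refine ⟨⟨hd, hm⟩, ?_⟩
    rw [Nat.lt_iff_add_one_le, Nat.le_div_iff_mul_le hd0, Nat.mul_comm]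
    exact h1

/-- The pairs `de = m` with `e > M₀`, as a sum over the small divisor `d ≤ m / (M₀ + 1)` against
the indicator of `d ∣ m`: `∑_{de = m, e > M₀} μ(d) log e = ∑_{d ≤ m/(M₀+1)} μ(d) 𝟙[d ∣ m] log(m/d)`.
[folklore] -/
theorem sum_antidiagonal_large_eq (m M₀ : ℕ) :
    ∑ x ∈ (Nat.divisorsAntidiagonal m).filter (fun x : ℕ × ℕ => ¬ x.2 ≤ M₀),
        (μ x.1 : ℝ) * Real.log x.2 =
      ∑ d ∈ Icc 1 (m / (M₀ + 1)),
        (μ d : ℝ) * (if d ∣ m then (1 : ℝ) else 0) * Real.log ((m : ℝ) / d) := by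
  rw [Finset.sum_filter,
    Nat.sum_divisorsAntidiagonal (fun d e => if ¬ e ≤ M₀ then (μ d : ℝ) * Real.log e else 0),
    ← Finset.sum_filter, filter_divisors_eq]
  have h : ∀ d ∈ Icc 1 (m / (M₀ + 1)),
      (μ d : ℝ) * (if d ∣ m then (1 : ℝ) else 0) * Real.log ((m : ℝ) / d) =
        if d ∣ m then (μ d : ℝ) * Real.log ((m : ℝ) / d) else 0 := by
    intro d _
    split_ifs <;> ring
  rw [Finset.sum_congr rfl h, ← Finset.sum_filter]
  refine Finset.sum_congr rfl fun d hd => ?_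
  simp only [Finset.mem_filter, Finset.mem_Icc] at hd
  have hd0 : (d : ℝ) ≠ 0 := by exact_mod_cast (Nat.one_le_iff_ne_zero.mp hd.1.1)
  rw [Nat.cast_div hd.2 hd0]

/-- The exact splitting of `Λ(m)` behind the rung: atoms pairs (`e ≤ M₀`), level piece and main
piece (`e > M₀`, indicator `𝟙[d ∣ m] = W d + (𝟙[d ∣ m] - W d)`), for any weights `W`. [folklore] -/
theorem vonMangoldt_split (m M₀ : ℕ) (W : ℕ → ℝ) :
    (Λ m : ℝ) =
      ∑ x ∈ (Nat.divisorsAntidiagonal m).filter (fun x : ℕ × ℕ => x.2 ≤ M₀),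
          (μ x.1 : ℝ) * Real.log x.2 +
        ∑ d ∈ Icc 1 (m / (M₀ + 1)),
          (μ d : ℝ) * ((if d ∣ m then (1 : ℝ) else 0) - W d) * Real.log ((m : ℝ) / d) +
        ∑ d ∈ Icc 1 (m / (M₀ + 1)), (μ d : ℝ) * W d * Real.log ((m : ℝ) / d) := by
  rw [vonMangoldt_eq_sum_antidiagonal,
    ← Finset.sum_filter_add_sum_filter_not _ (fun x : ℕ × ℕ => x.2 ≤ M₀),
    sum_antidiagonal_large_eq, add_assoc, ← Finset.sum_add_distrib]
  congr 1
  exact Finset.sum_congr rfl fun d _ => by ring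

/-- Summing `Λ(m(n)) F(n)` over `n ≤ N`: `S(N) = A(N) + E(N) + M(N)` exactly, for any weights
`F`, arguments `m(n)`, cut `M₀` and sieve weights `W`. [folklore] -/
theorem sum_vonMangoldt_mul_split (F : ℕ → ℝ) (m : ℕ → ℕ) (N M₀ : ℕ) (W : ℕ → ℝ) :
    ∑ n ∈ Icc 1 N, (Λ (m n) : ℝ) * F n =
      ∑ n ∈ Icc 1 N, F n *
          ∑ x ∈ (Nat.divisorsAntidiagonal (m n)).filter (fun x : ℕ × ℕ => x.2 ≤ M₀),
            (μ x.1 : ℝ) * Real.log x.2 +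
        ∑ n ∈ Icc 1 N, F n *
          ∑ d ∈ Icc 1 (m n / (M₀ + 1)),
            (μ d : ℝ) * ((if d ∣ m n then (1 : ℝ) else 0) - W d) * Real.log ((m n : ℝ) / d) +
        ∑ n ∈ Icc 1 N, F n *
          ∑ d ∈ Icc 1 (m n / (M₀ + 1)), (μ d : ℝ) * W d * Real.log ((m n : ℝ) / d) := by
  rw [← Finset.sum_add_distrib, ← Finset.sum_add_distrib]
  refine Finset.sum_congr rfl fun n _ => ?_
  rw [vonMangoldt_split (m n) M₀ W]
  ring

/-! ### The system `vecCons ψ Φ` -/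

/-- `∏_{i ≤ t} Λ((vecCons ψ Φ)ᵢ(n)) = Λ(m) · ∏_{i < t} Λ(Φᵢ(n))` with `m = ψ(n).toNat`
(`Λ` on `ℤ` is `Λ ∘ toNat`). [folklore] -/
theorem prod_vecCons_eq (Φ : Fin t → AffLinForm 1) (ψ : AffLinForm 1) (n : ℕ) :
    ∏ i, intVonMangoldt ((Matrix.vecCons ψ Φ i).eval ![(n : ℤ)]) =
      (Λ (Int.toNat (ψ.eval ![(n : ℤ)])) : ℝ) * ∏ i, intVonMangoldt ((Φ i).eval ![(n : ℤ)]) := by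
  rw [Fin.prod_univ_succ]
  simp only [Matrix.cons_val_zero, Matrix.cons_val_succ]
  rfl

/-! ### `ε/3` bookkeeping -/

/-- If `S = A + E + M` with `|A(N)|, |E(N)| ≤ η N` and `|M(N) - c N| ≤ η N` for all large `N`,
for every `η > 0`, then `S(N) - c N = o(N)`. [folklore] -/
theorem isLittleO_of_pieces (S A E M : ℕ → ℝ) (c : ℝ)
    (hA : ∀ η : ℝ, 0 < η → ∃ N₀ : ℕ, ∀ N : ℕ, N₀ ≤ N → |A N| ≤ η * N)
    (hE : ∀ η : ℝ, 0 < η → ∃ N₀ : ℕ, ∀ N : ℕ, N₀ ≤ N → |E N| ≤ η * N)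
    (hM : ∀ η : ℝ, 0 < η → ∃ N₀ : ℕ, ∀ N : ℕ, N₀ ≤ N → |M N - c * N| ≤ η * N)
    (hS : ∀ N, S N = A N + E N + M N) :
    (fun N : ℕ => S N - c * N) =o[atTop] fun N : ℕ => (N : ℝ) := by
  refine Asymptotics.isLittleO_iff.mpr fun κ hκ => ?_
  obtain ⟨NA, hNA⟩ := hA (κ / 3) (by positivity)
  obtain ⟨NE, hNE⟩ := hE (κ / 3) (by positivity)
  obtain ⟨NM, hNM⟩ := hM (κ / 3) (by positivity)
  refine Filter.eventually_atTop.mpr ⟨max NA (max NE NM), fun N hN => ?_⟩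
  have h1 := hNA N ((le_max_left _ _).trans hN)
  have h2 := hNE N ((le_max_left _ _).trans ((le_max_right _ _).trans hN))
  have h3 := hNM N ((le_max_right _ _).trans ((le_max_right _ _).trans hN))
  rw [Real.norm_eq_abs, Real.norm_eq_abs, Nat.abs_cast N, hS N]
  calc |A N + E N + M N - c * N| = |A N + E N + (M N - c * N)| := by rw [add_sub_assoc]
    _ ≤ |A N| + |E N| + |M N - c * N| := abs_add_three _ _ _
    _ ≤ κ / 3 * N + κ / 3 * N + κ / 3 * N := by linarith
    _ = κ * N := by ring

/-- **The rung from its three pieces.** For the system `vecCons ψ Φ`, any weights `W` and any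
exponent `ε₁` (`M₀ = ⌊N^{ε₁}⌋`): if the atoms piece (A) and the level piece (E) are `o(N)` and the
main piece (M) is `𝔖(vecCons ψ Φ) N + o(N)`, then
`∑_{n ≤ N} ∏ᵢ Λ((vecCons ψ Φ)ᵢ(n)) = 𝔖(vecCons ψ Φ) N + o(N)`. [folklore] -/
theorem rung_of_pieces (Φ : Fin t → AffLinForm 1) (ψ : AffLinForm 1) (W : ℕ → ℝ) (ε₁ : ℝ)
    (hA : ∀ η : ℝ, 0 < η → ∃ N₀ : ℕ, ∀ N : ℕ, N₀ ≤ N →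
      |∑ n ∈ Icc 1 N, (∏ i, intVonMangoldt ((Φ i).eval ![(n : ℤ)])) *
          ∑ x ∈ (Nat.divisorsAntidiagonal (Int.toNat (ψ.eval ![(n : ℤ)]))).filter
            (fun x : ℕ × ℕ => x.2 ≤ ⌊(N : ℝ) ^ ε₁⌋₊), (μ x.1 : ℝ) * Real.log x.2| ≤ η * N)
    (hE : ∀ η : ℝ, 0 < η → ∃ N₀ : ℕ, ∀ N : ℕ, N₀ ≤ N →
      |∑ n ∈ Icc 1 N, (∏ i, intVonMangoldt ((Φ i).eval ![(n : ℤ)])) *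
          ∑ d ∈ Icc 1 (Int.toNat (ψ.eval ![(n : ℤ)]) / (⌊(N : ℝ) ^ ε₁⌋₊ + 1)),
            (μ d : ℝ) * ((if d ∣ Int.toNat (ψ.eval ![(n : ℤ)]) then (1 : ℝ) else 0) - W d) *
              Real.log ((Int.toNat (ψ.eval ![(n : ℤ)]) : ℝ) / d)| ≤ η * N)
    (hM : ∀ η : ℝ, 0 < η → ∃ N₀ : ℕ, ∀ N : ℕ, N₀ ≤ N →
      |∑ n ∈ Icc 1 N, (∏ i, intVonMangoldt ((Φ i).eval ![(n : ℤ)])) *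
          ∑ d ∈ Icc 1 (Int.toNat (ψ.eval ![(n : ℤ)]) / (⌊(N : ℝ) ^ ε₁⌋₊ + 1)),
            (μ d : ℝ) * W d * Real.log ((Int.toNat (ψ.eval ![(n : ℤ)]) : ℝ) / d) -
        singularProduct (Matrix.vecCons ψ Φ) * N| ≤ η * N) :
    (fun N : ℕ => ∑ n ∈ Icc 1 N, ∏ i, intVonMangoldt ((Matrix.vecCons ψ Φ i).eval ![(n : ℤ)]) -
        singularProduct (Matrix.vecCons ψ Φ) * N) =o[atTop] fun N : ℕ => (N : ℝ) := by
  refine isLittleO_of_pieces _ _ _ _ _ hA hE hM fun N => ?_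
  rw [Finset.sum_congr rfl fun n _ => prod_vecCons_eq Φ ψ n]
  exact sum_vonMangoldt_mul_split _ _ N _ W

end RungAssembly

open RungAssembly in
/-- **The rung of the sloped ladder, assembled** (Bombieri's asymptotic sieve, one step
`ElemHL_t ∧ Level_t ∧ Atoms_t ⇒ ElemHL_{t+1}`): given the atoms piece (A), the level piece (E)
and the main piece (M) for every positive non-degenerate `vecCons ψ Φ`, every positive
non-degenerate `(t+1)`-system `Φ'` satisfies
`∑_{n ≤ N} ∏ᵢ Λ(Φ'ᵢ(n)) = 𝔖(Φ') N + o(N)` — reduce to `Φ' = vecCons (Φ' 0) (tail Φ')`, open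
`Λ((Φ' 0)(n))` by `Λ = μ * log`, split the divisor pairs at `M₀ = ⌊N^{ε₁}⌋`, and add the three
bounds. [folklore] -/
theorem stub_slopedRung :
    ∀ t : ℕ, 1 ≤ t →
      (∀ (Φ : Fin t → Literature.NumberTheory.Sieve.AffLinForm 1) (ψ : Literature.NumberTheory.Sieve.AffLinForm 1), Literature.NumberTheory.Sieve.IsNondegenerateSystem (Matrix.vecCons ψ Φ) → (∀ i, 0 < (Φ i).coeff 0 ∧ 0 ≤ (Φ i).const) → (0 < ψ.coeff 0 ∧ 0 ≤ ψ.const) → ∃ ε₁ : ℝ, 0 < ε₁ ∧ ε₁ ≤ 1 / 8 ∧ ∀ η : ℝ, 0 < η → ∃ N₀ : ℕ, ∀ N : ℕ, N₀ ≤ N → |∑ n ∈ Finset.Icc 1 N, (∏ i, Literature.NumberTheory.Sieve.intVonMangoldt ((Φ i).eval ![(n : ℤ)])) * ∑ x ∈ (Nat.divisorsAntidiagonal (Int.toNat (ψ.eval ![(n : ℤ)]))).filter (fun x : ℕ × ℕ => x.2 ≤ ⌊(N : ℝ) ^ ε₁⌋₊), (ArithmeticFunction.moebius x.1 : ℝ)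 * Real.log x.2| ≤ η * N) →
      (∀ (Φ : Fin t → Literature.NumberTheory.Sieve.AffLinForm 1) (ψ : Literature.NumberTheory.Sieve.AffLinForm 1), Literature.NumberTheory.Sieve.IsNondegenerateSystem (Matrix.vecCons ψ Φ) → (∀ i, 0 < (Φ i).coeff 0 ∧ 0 ≤ (Φ i).const) → (0 < ψ.coeff 0 ∧ 0 ≤ ψ.const) → ∀ ε₁ : ℝ, 0 < ε₁ → ε₁ ≤ 1 / 8 → ∀ η : ℝ, 0 < η → ∃ N₀ : ℕ, ∀ N : ℕ, N₀ ≤ N → |∑ n ∈ Finset.Icc 1 N, (∏ i, Literature.NumberTheory.Sieve.intVonMangoldt ((Φ i).eval ![(n : ℤ)])) * ∑ d ∈ Finset.Icc 1 (Int.toNat (ψ.eval ![(n : ℤ)]) / (⌊(N : ℝ) ^ ε₁⌋₊ + 1)), (ArithmeticFunction.moebius d : ℝ) * ((if d ∣ Int.toNat (ψ.eval ![(n : ℤ)]) then (1 : ℝ) else 0) - (∑ ρ ∈ Finset.range (d / Int.gcd (ψ.coeff 0) d), if (d : ℤ) ∣ ψ.eval ![(ρ : ℤ)] then (if ∀ i,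 Int.gcd ((Φ i).eval ![(ρ : ℤ)]) (d / Int.gcd (ψ.coeff 0) d) = 1 then ((((Finset.range (d / Int.gcd (ψ.coeff 0) d)).filter (fun ρ' : ℕ => ∀ i, Int.gcd ((Φ i).eval ![(ρ' : ℤ)]) (d / Int.gcd (ψ.coeff 0) d) = 1)).card : ℝ))⁻¹ else 0) else (0 : ℝ))) * Real.log ((Int.toNat (ψ.eval ![(n : ℤ)]) : ℝ) / d)| ≤ η * N) →
      (∀ (Φ : Fin t → Literature.NumberTheory.Sieve.AffLinForm 1) (ψ : Literature.NumberTheory.Sieve.AffLinForm 1), Literature.NumberTheory.Sieve.IsNondegenerateSystem (Matrix.vecCons ψ Φ) → (∀ i, 0 < (Φ i).coeff 0 ∧ 0 ≤ (Φ i).const) → (0 < ψ.coeff 0 ∧ 0 ≤ ψ.const) → ∀ ε₁ : ℝ, 0 < ε₁ → ε₁ ≤ 1 / 8 → ∀ η : ℝ, 0 < η → ∃ N₀ : ℕ, ∀ N : ℕ, N₀ ≤ N → |∑ n ∈ Finset.Icc 1 N, (∏ i, Literature.NumberTheory.Sieve.intVonMangoldt ((Φ i).eval ![(n : ℤ)]))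 * ∑ d ∈ Finset.Icc 1 (Int.toNat (ψ.eval ![(n : ℤ)]) / (⌊(N : ℝ) ^ ε₁⌋₊ + 1)), (ArithmeticFunction.moebius d : ℝ) * (∑ ρ ∈ Finset.range (d / Int.gcd (ψ.coeff 0) d), if (d : ℤ) ∣ ψ.eval ![(ρ : ℤ)] then (if ∀ i, Int.gcd ((Φ i).eval ![(ρ : ℤ)]) (d / Int.gcd (ψ.coeff 0) d) = 1 then ((((Finset.range (d / Int.gcd (ψ.coeff 0) d)).filter (fun ρ' : ℕ => ∀ i, Int.gcd ((Φ i).eval ![(ρ' : ℤ)]) (d / Int.gcd (ψ.coeff 0) d) = 1)).card : ℝ))⁻¹ else 0) else (0 : ℝ)) * Real.log ((Int.toNat (ψ.eval ![(n : ℤ)]) : ℝ) / d) - Literature.NumberTheory.Sieve.singularProduct (Matrix.vecCons ψ Φ) * N| ≤ η * N) →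
      ∀ Φ : Fin (t + 1) → Literature.NumberTheory.Sieve.AffLinForm 1, Literature.NumberTheory.Sieve.IsNondegenerateSystem Φ → (∀ i, 0 < (Φ i).coeff 0 ∧ 0 ≤ (Φ i).const) → ((fun N : ℕ => ∑ n ∈ Finset.Icc 1 N, ∏ i, Literature.NumberTheory.Sieve.intVonMangoldt ((Φ i).eval ![(n : ℤ)]) - Literature.NumberTheory.Sieve.singularProduct Φ * N) =o[Filter.atTop] fun N : ℕ => (N : ℝ)) := by
  intro t _ hA hE hM Φ' hnd hpos
  have hcons : Matrix.vecCons (Φ' 0) (Fin.tail Φ') = Φ' := Fin.cons_self_tail Φ'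
  have hnd' : IsNondegenerateSystem (Matrix.vecCons (Φ' 0) (Fin.tail Φ')) := by
    rw [hcons]
    exact hnd
  have hposΦ : ∀ i, 0 < (Fin.tail Φ' i).coeff 0 ∧ 0 ≤ (Fin.tail Φ' i).const := fun i =>
    hpos i.succ
  obtain ⟨ε₁, hε₁, hε₁', hA'⟩ := hA (Fin.tail Φ') (Φ' 0) hnd' hposΦ (hpos 0)
  have hE' := hE (Fin.tail Φ') (Φ' 0) hnd' hposΦ (hpos 0) ε₁ hε₁ hε₁'
  have hM' := hM (Fin.tail Φ') (Φ' 0) hnd' hposΦ (hpos 0) ε₁ hε₁ hε₁'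
  rw [← hcons]
  exact rung_of_pieces (Fin.tail Φ') (Φ' 0) _ ε₁ hA' hE' hM'

end Summit.Parity.GeneralizedHardyLittlewood.Theorems.PairsToGHL.SlopedLadder
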